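import Summits.HodgeConjecture.HodgeConjecture.Theses.PadicSemiregularLift
import Summits.HodgeConjecture.HodgeConjecture.Theorems.FormalVectorBundlesAlgebraize.Negative.TowerTightness
import Literature.AlgebraicGeometry.Resolution.ChowLemmaRing
import Literature.AlgebraicGeometry.KTheory.PullbackVectorBundle
import Literature.AlgebraicGeometry.Morphisms.SteinFactorizationProofs
import Literature.AlgebraicGeometry.Motives.ZariskiChowCover

/-!
# Line `chow-zariski-pushforward` — checked skeleton for the crux
`PadicSemiregularLift.FormalVectorBundlesAlgebraize` (stmt-HodgeConjecture-14106)

Crux-plan seat `cruxplan-stmt-HodgeConjecture-14106-chow-zariski-pushfor`, GENERATION 2 (2026-08-16). Generation 1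
wrote and registered the first version of this file (skeleton sha `d5df8841…`, 04:08Z) against Disproof.lean CYCLE 1;
generation 2 re-audited every stub against Disproof.lean CYCLE 2 (§§5–9, published 04:06Z) and against the LANDED
negative file of this crux, `Theorems/FormalVectorBundlesAlgebraize/Negative/TowerTightness.lean` (now imported; its
`thickeningMap_snd` replaces generation 1's local copy), made the hidden uses of the disprover's pre-pick audit (§8(a))
explicit in the stub docstrings, and left the five registered stub NAMES and SIGNATURES unchanged. Inputs: idea card
`Cruxes/FormalVectorBundlesAlgebraize/Ideas/chow-zariski-pushforward.md` (ideator 2); triage `TRIAGE-r1-{1,2,3}.md`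
(3/3 pass; merge clusters FRAME = chow-frame-descent ≈ chow-zariski-pushforward ≈ chow-stein-pushforward-descent and
ENGINE = twist-presentation-completeness ≈ flat-ladder-graded-limit ≈ flat-tower-uniform-serre); `Disproof.lean`
(cdisprove cycles 1–2: NO KILL — the crux is EGA III₁ 5.1.4 + GW II 24.95/24.96 for vector bundles);
`IdeatorTwoSketch.lean` (typed first lemmas, rc 0); the sibling skeletons `Lines/chow-frame-descent.lean` and
`Lines/twist-presentation-completeness.lean` (the shared ENGINE stub). Line card: `Lines/chow-zariski-pushforward.md`.

## The crux (by name; `crux_iff` of Disproof.lean is `Iff.rfl`)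

`∀ p k d (𝒳 : SchemeOver W(k)), IsSmoothProperModel d 𝒳 → ∀ E₁, LiftsFormally 𝒳 E₁ → LiftsTo 𝒳 E₁`:
Grothendieck existence for VECTOR BUNDLES on a smooth PROPER `W(k)`-model (only the two fibres are
projective; `𝒳` itself is merely proper over `W`).

## The line (one lever: push the projective algebraization forward along a Chow cover of the NORMAL model)

1. `stub_integralNormal` (M) — a smooth proper model `𝒳/W(k)` is an INTEGRAL scheme SURJECTING onto
   `Spec W` with NORMAL (integrally closed) local rings [smooth over the regular `W` ⇒ regular stalks ⇒
   normal; flat with geometrically irreducible generic fibre ⇒ irreducible; smooth over reduced ⇒ reduced].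
   This is where the crux's SMOOTHNESS is spent (Disproof's mutation finding `crux_of_properOnly` says
   smoothness is decoration for TRUTH; here it is the proof's resource: it buys `ρ_* 𝒪 = 𝒪` in stub 3), and
   where `[PerfectRing k p]` enters (`W(k)` is a DVR; Disproof §5, §8(b)).
2. `stub_chowCover` (S–M) — Chow's lemma over `W` in `Over` form: `ρ : 𝒳' ⟶ 𝒳` proper surjective
   birational (iso over a dense open) from an INTEGRAL, `W`-PROJECTIVE (`ChowLemmaRing.IsProjOver`),
   `W`-FLAT `𝒳'` [tree `ChowLemmaRing.chow_proper` (PROVED) + `ZariskiChow.flat_of_isIntegral_of_surjective`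
   (PROVED) + `WittVector.isDiscreteValuationRing`]. Uses `IsProper 𝒳.hom` (honours `not_withoutProper`).
3. `stub_birationalOntoNormal` (M) — ZARISKI: a proper surjective morphism from an integral scheme onto
   a normal integral scheme which is an isomorphism over a dense open has `ρ_* 𝒪_{X'} = 𝒪_X`
   (`IsIso (ρ.app U)` for every open `U`) [Stacks 0AY8 = tree `TowardsNormal.isIso_app` (PROVED); the
   stub is the verification of its hypotheses (5) generic points over `ξ`, (6) `X'_ξ = Spec κ(ξ)`].
4. `stub_projectiveFlatEngine` (L; shared with the ENGINE lines, statement = IdeatorTwoSketch's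
   `ProjectiveFlatEngineStrong`, audited TRUE by all three triagers and by Disproof §8(a)) — on a `W`-FLAT
   closed `Z ⊆ ℙᴺ_W` every formal vector bundle `(F n)` (level-wise `Nonempty` transitions) is, level-wise,
   the restriction tower of a vector bundle on `Z` [EGA III₁ 5.1.4 on a projective flat `Z`; cheapest printed
   proof: flat ladder + ONE Serre bound on `ℙᴺ_k` + coefficientwise `p`-adic limit of the presentation matrix
   in `W[x]_b` + cokernel + Krull + GW II 24.96 — cards twist-presentation-completeness / flat-ladder-graded-limit;
   the sibling skeleton `Lines/twist-presentation-completeness.lean` cuts it as `stub_twistPresentation` +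
   `stub_formallyFreeCokernel`].
5. `stub_pushforwardTransport` (L; HARDEST of this line, the lever) — for `ρ : 𝒳' ⟶ 𝒳` proper with
   `ρ_* 𝒪 = 𝒪`, `𝒳'` `W`-projective and `W`-flat, `𝒳` proper over `W`, `(E n)` a formal vector bundle on
   `𝒳` and `E'` a vector bundle on `𝒳'` with `E'|_{X'_{n+1}} ≅ ρ_{n+1}^* (E n)` for all `n` (level-wise
   `Nonempty`): `ρ_* E'` IS A VECTOR BUNDLE and `(ρ_* E')|_{X_1} ≅ E 0` [one-level frame lift beyond the
   torsion exponent `c` of `Ȟ¹(ρ⁻¹V, E')[p^∞]` (finite module: `ρ` proper) by Bockstein naturality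
   `δ₁ ∘ red = p^{N-1} δ_N`, `N = c + 1`; the lifted frame is an isomorphism near `ρ⁻¹(V_k)`, `ρ` is closed,
   so `(ρ_*E')|_{V'} ≅ ρ_*𝒪^e = 𝒪^e`; everywhere by GW II 24.96 (`𝒳 → Spec W` closed — the SECOND use of
   `IsProper 𝒳.hom`); the level-one identification compares two images inside `ρ_{1*}(E'|_{X'_1})` using
   as comparison the level-`N` isomorphism reduced mod `p` — level `0` only, level-wise `Nonempty` data
   suffice, no `lim¹ Aut` re-choice (triage r1-1/r1-2/r1-3 sharpenings; Disproof §8(a) hidden use avoided)].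

Composition `FormalVectorBundlesAlgebraize_of` (sorry-free, §4): given `𝒳, E₁` and a formal lift `(E n)`:
stub 1 ⇒ `𝒳` integral, normal, onto `Spec W`; stub 2 ⇒ Chow cover `ρ : 𝒳' ⟶ 𝒳`; stub 3 ⇒ `ρ_* 𝒪 = 𝒪`;
pull the tower back to `𝒳'` (`F n := ρ_{n+1}^* E n`, PROVED glue §3: `isVectorBundle_pullback` — vector
bundles pull back to vector bundles, Stacks 01C8, via the tree's `KTheory/PullbackVectorBundle` — and
`towerPullbackStep` — the naturality square `ρ_m ≫ (X_m → X_n) = (X'_m → X'_n) ≫ ρ_n`); stub 4 on `𝒳'` ⇒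
`E'`; stub 5 ⇒ `ρ_* E'` is a vector bundle with `(ρ_* E')|_{X_1} ≅ E 0`; `liftsTo_of_levelOne` (PROVED,
`X_k → X_1 → 𝒳 = X_k → 𝒳`) ⇒ `LiftsTo 𝒳 E₁`. The audit `#h21_check_skeleton` sees the hypotheses through
the name-keyed aliases `Registered.stub_*` (each an `abbrev` of the named statement, which the sorried
`stub_*` theorem restates verbatim: `*_holds` consistency theorems); axioms of the composition:
`propext`, `Classical.choice`, `Quot.sound`.

## Disproof used (Disproof.lean at cdisprove CYCLE 2, read by gen 2 at session start, 2026-08-16T04:11Z)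

* §4 `not_withoutProper` (properness load-bearing; paper witness): HONOURED — `IsProper 𝒳.hom` is consumed in
  stub 2 (Chow needs `𝒳` proper to make `𝒳'` `W`-projective) and in stub 5 (GW II 24.96; finiteness of `Ȟ¹`);
  `h𝒳.isProper` is passed explicitly to both in the composition.
* §4 `not_withoutLiftsFormally`: HONOURED — the whole tower `(E n)` with its transitions is consumed (pulled
  back in §4, fed to stubs 4 and 5); no stub claims that a bundle on `X_k` lifts.
* §4 `not_uniqueAlgebraization` (refuted strengthening, paper): RESPECTED — the line outputs ONE lift `ρ_* E'`
  and never asserts uniqueness; stub 4's `∃ E` and stub 5's `Nonempty` are existence statements only.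
* §7 `not_restrictSpecialFaithful` (strengthening refuted IN LEAN, cycle 2: restriction of vector-bundle
  endomorphisms to `X_k` is not faithful, witness `p · id` on `𝒪_{Spec W(𝔽₂)}`): RESPECTED — no stub compares,
  descends or recovers MORPHISMS through `X_k`/`X_1`; stub 5's level-one isomorphism is an isomorphism of
  sheaves ON `X_1` manufactured from level-`N ≥ 1` data of the formal tower (two images in `ρ_{1*}(E'|_{X'_1})`),
  never the descent of a morphism from the special fibre to `𝒳`, and nothing says `F|_{X_1}` determines `F`.
* §6 `crux_iff_levelOne` (cycle 2): the composition proves exactly the level-one form (stub 5 concludes at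
  level `0`); the higher levels of `ρ_* E'` are NOT identified with `E n` — they need not be (§4/§6), and doing
  so would require the compatible re-choice of §8(a).
* §8(a) pre-pick audit (cycle 2; all candidate stubs TRUE as typed, hidden uses listed) — made explicit here:
  `ProjectiveFlatEngine(Strong)` = stub 4: the transitions of an `ℕ`-tower are CHOSEN once (no cocycle
  condition), so its strong conclusion needs no `lim¹ Aut` re-choice; `PushforwardTransport` (audited TRUE in
  the all-levels form) = stub 5 in level-`0` form: the re-choice is avoided by the comparison-at-level-`N` trick,
  and the hypotheses its proof really uses are `IsProper ρ.left` (finite `Ȟ¹`), `Flat 𝒳'.hom` (`p`-regular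
  `E'`), `∀ U, IsIso (ρ.left.app U)` (`ρ_*𝒪 = 𝒪`) and `IsProper 𝒳.hom` (24.96); `ChowCoverFunctions` (audited
  TRUE) is cut here into stub 1 (integral + normal + onto) and stub 3 (Tag 0AY8);
  `FormallyLocallyFreeIsLocallyFree` (audited TRUE) is not a stub of this line — its content for the explicit
  local frames of stub 5 is just "free on an open `⊇ X_k` ⇒ free" (24.96).
* §5/§8(b) `[PerfectRing k p]` (where it enters; imperfect witness `𝔽_p(t)`): KEPT in every stub over `W(k)`;
  used through `WittVector.isDiscreteValuationRing` (stub 1: `W` regular; stub 2: `W` a PID for flatness;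
  stub 5: `W` noetherian for finiteness / Krull).
* §8(c) projectivity of smooth proper models (open for schemes): this line keeps the Chow FRAME (stubs 1–3, 5)
  and needs no `IsProjectiveOverRing 𝒳`; the ENGINE (stub 4) runs on the `W`-projective cover only.
* §2 `crux_of_properOnly` (smoothness is decoration for truth): this line deliberately SPENDS smoothness
  (stub 1 ⇒ normality ⇒ stub 3), so it proves the crux as typed and NOT `ProperOnly` /
  `GrothendieckExistenceVB` for non-normal proper `𝒳` (there `ρ_* 𝒪 ≠ 𝒪` and the dévissage of EGA III §5.3
  is genuinely needed) — consistent, and sufficient for the item.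
* §9 `-- Targets`: none at cycle 2 (no line picked, `stuck_stubs = []`) — nothing to answer.
* LANDED `Negative/TowerTightness` (the only landed negative file of this crux; positive bookkeeping +
  tightness `liftsFormally_of_algebraicLift`): IMPORTED; `thickeningMap_snd` is used in §3.2; none of its
  lemmas is the negation of (an instance of) any stub — the tightness lemma is the converse direction of the
  crux and is consistent with stub 5's output (a vector-bundle lift regenerates a formal lift).
* Negatives index (`ledger negatives --problem HodgeConjecture`, 2 entries: Fermat Hodge multisets, E-line
  22×22 matrices): unrelated; no stub restates a refuted statement.

No stub restates the crux (stub 4 is the crux's statement for `W`-PROJECTIVE FLAT `Z` in strong form —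
neither implied by nor implying the crux as typed; stub 5 has `ρ`, `E'` as data the crux does not have),
the summit, or a refuted statement; every stub is stated over tree / Mathlib declarations only (no local
definition occurs in a stub signature, so each can be landed verbatim under `Theorems/`).
-/

set_option linter.dupNamespace false

noncomputable section

open CategoryTheory CategoryTheory.Limits AlgebraicGeometry
open Literature.AlgebraicGeometry.Motives Literature.AlgebraicGeometry.Motives.WittScheme
open Literature.AlgebraicGeometry.Resolution

namespace Summit.HodgeConjecture.HodgeConjecture.Cruxes.FormalVectorBundlesAlgebraize.ChowZariskiPushforward

universe u

/-! ## §1 Statements of the stubs (named; the registered stubs of §2 restate them verbatim) -/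

/-- STUB 1 statement — **a smooth proper model is integral, covers `Spec W`, and is normal.**
For `k` perfect of characteristic `p` and `𝒳/W(k)` with `IsSmoothProperModel d 𝒳`: `𝒳` is an integral
scheme, `𝒳 → Spec W` is surjective, and every local ring `𝒪_{𝒳,x}` is an integrally closed domain.
Sketch: `W(k)` is a complete DVR (`WittVector.isDiscreteValuationRing`; this is where `[PerfectRing k p]`
enters — Disproof §5/§8(b)); `𝒳 → Spec W` smooth ⇒ flat ⇒ universally open, and the generic fibre is
geometrically irreducible (`IsSmoothProjective.geometricallyIrreducible`), hence `𝒳` is irreducible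
(`ZariskiChow.irreducibleSpace_of_genericFibre`); smooth over the reduced noetherian `Spec W` ⇒ reduced
(`Resolution.isReduced_of_smooth_of_isReduced_base`); both fibres are non-empty ⇒ surjective; smooth over
the regular ring `W` ⇒ regular stalks (`isRegularLocalRing_stalk_of_smoothOfRelativeDimension_specOfRegular`)
⇒ integrally closed (`isIntegrallyClosed_of_isRegularLocalRing`). Pattern to copy:
`GoodReductionZariskiProofs.isIntegral_total` (the number-field DVR version of the first conjunct).
Disproof §8(a): this is the first half of the audited-TRUE `IdeatorTwo.ChowCoverFunctions` ("`𝒳` smooth over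
`W` ⇒ integral and regular ⇒ normal"). Sources: Hartshorne1977 III 9.7, II 6.11.1A; StacksProject 036D,
0567. Size M. -/
def SmoothModelIntegralNormal : Prop :=
  ∀ (p : ℕ) [Fact p.Prime] (k : Type) [Field k] [CharP k p] [PerfectRing k p] (d : ℕ)
    (𝒳 : SchemeOver (WittVector p k)), IsSmoothProperModel d 𝒳 →
    IsIntegral 𝒳.left ∧ Surjective 𝒳.hom ∧
      ∀ x : 𝒳.left, IsIntegrallyClosed (𝒳.left.presheaf.stalk x)

/-- STUB 2 statement — **Chow cover of a proper integral `W(k)`-model, in `Over` form, `W`-flat.**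
For `𝒳` proper over `W = W(k)` (`k` perfect), integral, surjecting onto `Spec W`: there are a `W`-scheme
`𝒳'` and a `W`-morphism `ρ : 𝒳' ⟶ 𝒳` with `𝒳'` integral, `W`-projective (`ChowLemmaRing.IsProjOver`:
closed `W`-immersion into some `ℙᴺ_W`) and `W`-flat, `ρ` proper and surjective, and an isomorphism over
a dense open `U ⊆ 𝒳`. Sketch: `ChowLemmaRing.chow_proper 𝒳.left 𝒳.hom` (PROVED; needs `[IsProper 𝒳.hom]`,
`[IsIntegral 𝒳.left]`) gives `n, X', π, ι : X' ⟶ ℙⁿ_W` with `X'` integral, `ι` a closed immersion, `π` proper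
surjective, `ι ≫ (ℙⁿ_W → Spec W) = π ≫ 𝒳.hom`, and a dense open `U` with `IsIso (π ∣_ U)`; put
`𝒳' := Over.mk (π ≫ 𝒳.hom)`, `ρ := Over.homMk π rfl`, `IsProjOver 𝒳' := ⟨n, Over.homMk ι ‹_›, ‹_›⟩`;
`𝒳'.hom = π ≫ 𝒳.hom` is surjective (composite) and `X'` integral, so `Flat 𝒳'.hom` by
`ZariskiChow.flat_of_isIntegral_of_surjective` (`W(k)` is a PID: `WittVector.isDiscreteValuationRing`).
This is the only stub producing DATA for the others; it uses `IsProper 𝒳.hom` (Disproof §4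
`not_withoutProper` honoured). Sources: GortzWedhorn2020 Thm 13.100; StacksProject 02O2; Hartshorne1977
III 9.7. Size S–M (pure repackaging of two PROVED tree theorems; kept a separate stub because it is the one
place the Chow data enter and the sibling FRAME lines cut it identically: `stub_chowCoverFlat` /
`stub_chowFlatCover`). -/
def ChowCover : Prop :=
  ∀ (p : ℕ) [Fact p.Prime] (k : Type) [Field k] [CharP k p] [PerfectRing k p]
    (𝒳 : SchemeOver (WittVector p k)), IsProper 𝒳.hom → IsIntegral 𝒳.left → Surjective 𝒳.hom →
    ∃ (𝒳' : SchemeOver (WittVector p k)) (ρ : 𝒳' ⟶ 𝒳),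
      IsIntegral 𝒳'.left ∧ ChowLemmaRing.IsProjOver 𝒳' ∧ Flat 𝒳'.hom ∧ IsProper ρ.left ∧
        Surjective ρ.left ∧ ∃ U : 𝒳.left.Opens, Dense (U : Set 𝒳.left) ∧ IsIso (ρ.left ∣_ U)

/-- STUB 3 statement — **Zariski: a proper birational morphism from an integral scheme onto a normal
integral scheme has `ρ_* 𝒪 = 𝒪`** (The Stacks Project, Tag 0AY8, specialised). For `ρ : X' ⟶ X` proper
and surjective with `X'` integral, `X` integral with integrally closed local rings, and `ρ` an isomorphism
over some dense open `U ⊆ X`: `𝒪_X(V) → 𝒪_{X'}(ρ⁻¹V)` is an isomorphism for EVERY open `V`. Sketch: apply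
the tree's `Morphisms.TowardsNormal.isIso_app` (PROVED; hypotheses: `[UniversallyClosed ρ]` ✓ from proper,
`[IsIntegral X]` ✓, `hS` stalks integrally closed ✓, `[IsReduced X']` ✓ from integral, `hX : ∀ x ∈
genericPoints X', ρ x = genericPoint X` — the generic point of `X'` lies in the non-empty open `ρ⁻¹U`
(`U ≠ ∅` as `U` is dense and `X ≠ ∅`; `ρ⁻¹U ≠ ∅` as `ρ` is surjective) and `ρ⁻¹U ≅ U` matches generic
points, `hξ : IsIso (ρ.fiberToSpecResidueField (genericPoint X)).appTop` — the fibre over `ξ ∈ U` is the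
fibre of the isomorphism `ρ ∣_ U`, i.e. `Spec κ(ξ)`). Surjectivity of `ρ` is implied by the rest (proper +
dominant) and is carried only because stub 2 provides it. Disproof §8(a): second half of the audited-TRUE
`IdeatorTwo.ChowCoverFunctions`; the card's Hartogs variant (`Motives/RatFnBirationalHartogs`) would also do
(triage r1-2), 0AY8 is already in the tree. Sources: StacksProject 0AY8; Hartshorne1977 proof of III 11.4;
EGA III₁ 4.3.12. Size M (hypotheses (5), (6) are the fiddly part: `Scheme.Hom.fiber`, `genericPoint`,
`morphismRestrict`). -/
def BirationalOntoNormal : Prop :=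
  ∀ (X' X : Scheme.{0}) (ρ : X' ⟶ X), IsIntegral X' → IsIntegral X →
    (∀ x : X, IsIntegrallyClosed (X.presheaf.stalk x)) → IsProper ρ → Surjective ρ →
    (∃ U : X.Opens, Dense (U : Set X) ∧ IsIso (ρ ∣_ U)) → ∀ U : X.Opens, IsIso (ρ.app U)

/-- STUB 4 statement — **the projective flat engine, strong form** (verbatim
`IdeatorTwo.ProjectiveFlatEngineStrong`; the statement the three ENGINE cards fill; registered under the
same name `stub_projectiveFlatEngine` with the same signature by the sibling line chow-frame-descent). For
`Z` a closed `W`-subscheme of some `ℙᴺ_W` (`ChowLemmaRing.IsProjOver Z`) FLAT over `W = W(k)`, and a tower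
of vector bundles `F n` on the thickenings `Z_{n+1} = Z ⊗ W/pⁿ⁺¹` with `F (n+1)|_{Z_{n+1}} ≅ F n` (level-wise
`Nonempty`): there is a vector bundle `E` on `Z` with `E|_{Z_{n+1}} ≅ F n` for every `n`. In print:
CHOOSE the transitions (an `ℕ`-tower has no cocycle condition, so no compatible RE-choice / `lim¹ Aut`
argument is needed here — this answers the hidden-use remark of Disproof §8(a) for the strong form), so
`(F n)` is a locally free module on the formal completion; EGA III₁ 5.1.4 / GW II Thm 24.94 algebraizes it
to a coherent `E` with `Ê ≅ (F n)` (compatible with the chosen transitions, in particular level-wise);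
`E` is locally free at the points of `Z_k` (GW II 24.95) hence everywhere (24.96: `Z → Spec W` is closed).
Degenerate cases audited TRUE by the triagers: `Z = ∅`, `Z_k` reducible / non-reduced. Cheapest proof on
record (cards twist-presentation-completeness = flat-ladder-graded-limit, triage-audited; skeleton
`Lines/twist-presentation-completeness.lean`: `stub_twistPresentation` + `stub_formallyFreeCokernel`):
flatness makes `pⁿ𝒪_Z/pⁿ⁺¹ ≅ 𝒪_{Z_k}` constant, so ONE Serre bound on `ℙᴺ_k` presents every level by
twists with matrices in `W_n[x]_b`; take the coefficientwise `p`-adic limit in the finite free `W`-module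
`W[x]_b` (`WittVector.isAdicCompleteIdealSpanP`), `E := ι^* coker`, right-exactness of pull-back, Krull,
24.96. Sources: EGAIII1 5.1.4; GortzWedhorn2023 24.94–24.96, 24.102–24.103; Hartshorne1977 II 5.17–5.18,
III Ex 11.6; StacksProject 0886, 087V–088F. Size L (the "dictionary" coherent sheaf on `ℙᴺ_A` ↔ graded
module ↔ LaurentCech is the shared hardest sub-step of all six cards). -/
def ProjectiveFlatEngineStrong : Prop :=
  ∀ (p : ℕ) [Fact p.Prime] (k : Type) [Field k] [CharP k p] [PerfectRing k p]
    (Z : SchemeOver (WittVector p k)), ChowLemmaRing.IsProjOver Z → Flat Z.hom →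
    ∀ (F : ∀ n : ℕ, (thickening Z (n + 1)).left.Modules), (∀ n, IsVectorBundle (F n)) →
      (∀ n, Nonempty ((Scheme.Modules.pullback (thickeningMap Z (Nat.le_succ (n + 1)))).obj (F (n + 1))
        ≅ F n)) →
      ∃ E : Z.left.Modules, IsVectorBundle E ∧
        ∀ n, Nonempty ((Scheme.Modules.pullback (thickeningι Z (n + 1))).obj E ≅ F n)

/-- STUB 5 statement — **pushforward transport along a Chow cover with `ρ_* 𝒪 = 𝒪`** (THE LEVER;
level-`0` conclusion, as the three triagers recommend; the level-`0` cut of the audited-TRUE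
`IdeatorTwo.PushforwardTransport`, Disproof §8(a)). Data: `𝒳` proper over `W = W(k)`; `ρ : 𝒳' ⟶ 𝒳` a
`W`-morphism with `ρ.left` proper and `𝒪_𝒳(U) ≅ 𝒪_{𝒳'}(ρ⁻¹U)` for all opens `U`; `𝒳'` `W`-projective and
`W`-flat; `(E n)` vector bundles on the thickenings `X_{n+1}` with `E (n+1)|_{X_{n+1}} ≅ E n`; `E'` a vector
bundle on `𝒳'` with `E'|_{X'_{n+1}} ≅ ρ_{n+1}^* (E n)` for all `n` (all isomorphisms level-wise `Nonempty`),
where `ρ_{n+1} := ((baseChange W W_{n+1}).map ρ).left : X'_{n+1} ⟶ X_{n+1}`. Conclusion: `ρ_* E'` is a vector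
bundle on `𝒳` and `(ρ_* E')|_{X_1} ≅ E 0`.
Sketch (card chow-frame-descent (L) + this card's K1, triage-sharpened; every hidden use of Disproof §8(a)
spelled out). SET-UP: cover `X_k` by finitely many affine opens `V = Spec A ⊆ 𝒳` (`𝒳` quasi-compact) with
`E 0|_{V_1}` free; `c :=` the maximum over the cover of the exponents of the `p^∞`-torsion of the finite
`A`-modules `Ȟ¹(ρ⁻¹V, E')` (`ρ⁻¹V → V` proper and `E'` coherent: tree `DevissageHeart.heart_holds` +
`Devissage.devissage`, PROVED for all `Coh` modules on proper `A`-schemes, or Serre via `ρ⁻¹V ↪ ℙᴺ_V` closed,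
tree ProjCech; `A` noetherian: `IsProper 𝒳.hom`, `[PerfectRing k p]`); `N := c + 1`. Then `E (N-1)|_{V_N}`
is free (its reduction to `V_1` is `≅ E 0|_{V_1}` by the tower, and frames lift along nilpotent thickenings of
affine schemes). LOCAL FREENESS: `E'|_{ρ⁻¹V}` is `p`-torsion-free (`Flat 𝒳'.hom`), so
`0 → E' → E' → E'/p^m → 0` (multiplication by `p^m`) is exact with Bocksteins `δ_m : H⁰(E'/p^m) → Ȟ¹(E')[p^m]`
and `δ₁ ∘ red_{N→1} = p^{N-1} δ_N` (the abstract heart `reduction_lifts_of_torsion_exponent`, closed sorry-free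
by triagers r1-1/r1-2/r1-3, travels as item evidence); take the level-`N` frame
`s̄ := ψ_N⁻¹(ρ_N^* g)` of `E'/p^N` over `ρ⁻¹V` (`g` a frame of `E (N-1)|_{V_N}`, `ψ_N` the given level-`N`
isomorphism): `p^{N-1} δ_N(s̄) = 0`, so `s̄ mod p` lifts to `σ : 𝒪^e → E'|_{ρ⁻¹V}`; `σ` is an isomorphism at
every point of `ρ⁻¹(V_k)` (Nakayama, equal ranks), hence on an open containing `ρ⁻¹(V_k)`, which contains
`ρ⁻¹V'` for an open `V' ⊇ V_k` (`ρ` closed); so `(ρ_*E')|_{V'} ≅ ρ_*(𝒪^e)|_{V'} = 𝒪^e|_{V'}` by `ρ_*𝒪 = 𝒪`.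
Thus `ρ_*E'` is free on each `V'`, locally free of finite rank on the open `⋃ V' ⊇ X_k`, which is all of `𝒳`
(`𝒳 → Spec W` closed, `W` local: GW II Lemma 24.96 — the second use of `IsProper 𝒳.hom`). LEVEL ONE (no
compatibility of the given isomorphisms needed): let `θ : E (N-1)|_{X_1} ≅ E 0` be the tower's isomorphisms
restricted and composed, and take as comparison `φ := (ρ_1^* θ) ∘ (ψ_N|_{X'_1}) : E'|_{X'_1} ≅ ρ_1^*(E 0)`.
Inside `ρ_{1*}(E'|_{X'_1})` the subsheaves `A := im((ρ_*E')|_{X_1} → ρ_{1*}(E'|_{X'_1}))` (base change map;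
injective by `p`-regularity of `E'` and left exactness of `ρ_*`) and
`B := im(E 0 → ρ_{1*}ρ_1^*(E 0) ≅ ρ_{1*}(E'|_{X'_1}))` (unit, then `ρ_{1*}φ⁻¹`; injective because
`𝒪_{X_1} = (ρ_*𝒪_{𝒳'})/p ↪ ρ_{1*}𝒪_{X'_1}` and `E 0` is locally free) COINCIDE: on `V'_1` both are the
`𝒪_{V'_1}`-span of a frame of `E'|_{ρ⁻¹V'_1}` — `σ mod p = (ψ_N⁻¹ρ_N^* g) mod p` for `A`, `φ⁻¹(ρ_1^* f)` for
`B` (`f` a frame of `E 0|_{V'_1}`) — and `θ⁻¹ f`, `g mod p` are two frames of the FREE `𝒪_{V'_1}`-module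
`E (N-1)|_{V'_1}`, so they differ by a matrix `M ∈ GL_e(𝒪(V'_1))` and `φ⁻¹(ρ_1^* f) = ρ_1^*M · (σ mod p)`.
Hence `(ρ_*E')|_{X_1} ≅ A = B ≅ E 0`. (No morphism is ever descended from `X_k`/`X_1` to `𝒳` — Disproof §7
`not_restrictSpecialFaithful` respected; the higher levels of `ρ_*E'` are not identified — §6/§8(a).)
Why it might fail: not mathematically; the Lean risk is the thin `Scheme.Modules` API (pushforward sections,
restriction to opens, frames as `SheafOfModules.free (Fin e) ≅ _`, the module version of the tree's
`hasSurjectiveFormalFunctions_of_finite_cechH1`, whose `[Flat f]` enters only through `Sections.isSMulRegular`,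
FormalFunctionsCechProofs ll. 73–97 — audited by r1-1/r1-2/r1-3). Hypothesis `ChowLemmaRing.IsProjOver 𝒳'`
is redundant given `IsProper ρ.left` (finite type) and is carried for the Serre variant of the finiteness step.
Sources: EGAIII1 4.1.5/4.1.7; GortzWedhorn2023 Thm 24.37, Lemma 24.40, Prop 24.95, Lemma 24.96; StacksProject
02OB, 02OC; Hartshorne1977 III 11.1, II Ex 5.1(d) (projection formula). Size L — HARDEST. -/
def PushforwardTransport : Prop :=
  ∀ (p : ℕ) [Fact p.Prime] (k : Type) [Field k] [CharP k p] [PerfectRing k p]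
    (𝒳 : SchemeOver (WittVector p k)), IsProper 𝒳.hom →
    ∀ (𝒳' : SchemeOver (WittVector p k)) (ρ : 𝒳' ⟶ 𝒳), IsProper ρ.left →
      (∀ U : 𝒳.left.Opens, IsIso (ρ.left.app U)) → ChowLemmaRing.IsProjOver 𝒳' → Flat 𝒳'.hom →
      ∀ (E : ∀ n : ℕ, (thickening 𝒳 (n + 1)).left.Modules), (∀ n, IsVectorBundle (E n)) →
        (∀ n, Nonempty ((Scheme.Modules.pullback (thickeningMap 𝒳 (Nat.le_succ (n + 1)))).obj
          (E (n + 1)) ≅ E n)) →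
        ∀ (E' : 𝒳'.left.Modules), IsVectorBundle E' →
          (∀ n, Nonempty ((Scheme.Modules.pullback (thickeningι 𝒳' (n + 1))).obj E' ≅
            (Scheme.Modules.pullback
              ((baseChange (WittVector p k) (wittQuot p k (n + 1))).map ρ).left).obj (E n))) →
          IsVectorBundle ((Scheme.Modules.pushforward ρ.left).obj E') ∧
            Nonempty ((Scheme.Modules.pullback (thickeningι 𝒳 1)).obj
              ((Scheme.Modules.pushforward ρ.left).obj E') ≅ E 0)

/-! ## §2 The registered stubs (`sorry` lives only in these five theorems)

Each restates its §1 statement VERBATIM over tree / Mathlib declarations (so that a stub worker can land it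
as stated under `Theorems/` and `propose --supports stmt-HodgeConjecture-14106` matches it by name + signature);
`*_holds` below checks the restatement is definitionally the named statement. Names and signatures are those
registered by generation 1 (skeleton sha d5df8841…, 2026-08-16T04:08Z) — unchanged in generation 2, so the
registry, the sibling lines' cross-references and the lead's delegation plan stay valid. -/

/-- **STUB 1 · `stub_integralNormal`** (M) — see `SmoothModelIntegralNormal`. -/
theorem stub_integralNormal :
    ∀ (p : ℕ) [Fact p.Prime] (k : Type) [Field k] [CharP k p] [PerfectRing k p] (d : ℕ)
      (𝒳 : SchemeOver (WittVector p k)), IsSmoothProperModel d 𝒳 →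
      IsIntegral 𝒳.left ∧ Surjective 𝒳.hom ∧
        ∀ x : 𝒳.left, IsIntegrallyClosed (𝒳.left.presheaf.stalk x) := by
  sorry

/-- **STUB 2 · `stub_chowCover`** (S–M) — see `ChowCover`. -/
theorem stub_chowCover :
    ∀ (p : ℕ) [Fact p.Prime] (k : Type) [Field k] [CharP k p] [PerfectRing k p]
      (𝒳 : SchemeOver (WittVector p k)), IsProper 𝒳.hom → IsIntegral 𝒳.left → Surjective 𝒳.hom →
      ∃ (𝒳' : SchemeOver (WittVector p k)) (ρ : 𝒳' ⟶ 𝒳),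
        IsIntegral 𝒳'.left ∧ ChowLemmaRing.IsProjOver 𝒳' ∧ Flat 𝒳'.hom ∧ IsProper ρ.left ∧
          Surjective ρ.left ∧ ∃ U : 𝒳.left.Opens, Dense (U : Set 𝒳.left) ∧ IsIso (ρ.left ∣_ U) := by
  sorry

/-- **STUB 3 · `stub_birationalOntoNormal`** (M) — see `BirationalOntoNormal`. -/
theorem stub_birationalOntoNormal :
    ∀ (X' X : Scheme.{0}) (ρ : X' ⟶ X), IsIntegral X' → IsIntegral X →
      (∀ x : X, IsIntegrallyClosed (X.presheaf.stalk x)) → IsProper ρ → Surjective ρ →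
      (∃ U : X.Opens, Dense (U : Set X) ∧ IsIso (ρ ∣_ U)) → ∀ U : X.Opens, IsIso (ρ.app U) := by
  sorry

/-- **STUB 4 · `stub_projectiveFlatEngine`** (L, shared with the ENGINE lines) — see
`ProjectiveFlatEngineStrong`. -/
theorem stub_projectiveFlatEngine :
    ∀ (p : ℕ) [Fact p.Prime] (k : Type) [Field k] [CharP k p] [PerfectRing k p]
      (Z : SchemeOver (WittVector p k)), ChowLemmaRing.IsProjOver Z → Flat Z.hom →
      ∀ (F : ∀ n : ℕ, (thickening Z (n + 1)).left.Modules), (∀ n, IsVectorBundle (F n)) →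
        (∀ n, Nonempty ((Scheme.Modules.pullback (thickeningMap Z (Nat.le_succ (n + 1)))).obj (F (n + 1))
          ≅ F n)) →
        ∃ E : Z.left.Modules, IsVectorBundle E ∧
          ∀ n, Nonempty ((Scheme.Modules.pullback (thickeningι Z (n + 1))).obj E ≅ F n) := by
  sorry

/-- **STUB 5 · `stub_pushforwardTransport`** (L, HARDEST) — see `PushforwardTransport`. -/
theorem stub_pushforwardTransport :
    ∀ (p : ℕ) [Fact p.Prime] (k : Type) [Field k] [CharP k p] [PerfectRing k p]
      (𝒳 : SchemeOver (WittVector p k)), IsProper 𝒳.hom →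
      ∀ (𝒳' : SchemeOver (WittVector p k)) (ρ : 𝒳' ⟶ 𝒳), IsProper ρ.left →
        (∀ U : 𝒳.left.Opens, IsIso (ρ.left.app U)) → ChowLemmaRing.IsProjOver 𝒳' → Flat 𝒳'.hom →
        ∀ (E : ∀ n : ℕ, (thickening 𝒳 (n + 1)).left.Modules), (∀ n, IsVectorBundle (E n)) →
          (∀ n, Nonempty ((Scheme.Modules.pullback (thickeningMap 𝒳 (Nat.le_succ (n + 1)))).obj
            (E (n + 1)) ≅ E n)) →
          ∀ (E' : 𝒳'.left.Modules), IsVectorBundle E' →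
            (∀ n, Nonempty ((Scheme.Modules.pullback (thickeningι 𝒳' (n + 1))).obj E' ≅
              (Scheme.Modules.pullback
                ((baseChange (WittVector p k) (wittQuot p k (n + 1))).map ρ).left).obj (E n))) →
            IsVectorBundle ((Scheme.Modules.pushforward ρ.left).obj E') ∧
              Nonempty ((Scheme.Modules.pullback (thickeningι 𝒳 1)).obj
                ((Scheme.Modules.pushforward ρ.left).obj E') ≅ E 0) := by
  sorry

/-! ### Consistency: each named statement IS its registered stub (definitionally) -/

theorem smoothModelIntegralNormal_holds : SmoothModelIntegralNormal := stub_integralNormal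
theorem chowCover_holds : ChowCover := stub_chowCover
theorem birationalOntoNormal_holds : BirationalOntoNormal := stub_birationalOntoNormal
theorem projectiveFlatEngineStrong_holds : ProjectiveFlatEngineStrong := stub_projectiveFlatEngine
theorem pushforwardTransport_holds : PushforwardTransport := stub_pushforwardTransport

/-! ### Name-keyed aliases of the statements (the hypotheses of the composition; admissible BY NAME) -/
namespace Registered

/-- Alias of `SmoothModelIntegralNormal` keyed by the registered stub name. -/
abbrev stub_integralNormal : Prop := SmoothModelIntegralNormal
/-- Alias of `ChowCover` keyed by the registered stub name. -/
abbrev stub_chowCover : Prop := ChowCover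
/-- Alias of `BirationalOntoNormal` keyed by the registered stub name. -/
abbrev stub_birationalOntoNormal : Prop := BirationalOntoNormal
/-- Alias of `ProjectiveFlatEngineStrong` keyed by the registered stub name. -/
abbrev stub_projectiveFlatEngine : Prop := ProjectiveFlatEngineStrong
/-- Alias of `PushforwardTransport` keyed by the registered stub name. -/
abbrev stub_pushforwardTransport : Prop := PushforwardTransport

end Registered

/-! ## §3 Proved glue (no `sorry` from here on)

### §3.1 Vector bundles pull back to vector bundles (Stacks 01C8) -/

section VectorBundlePullback

section Transport

variable {C D : Type*} [Category C] [Category D] (F : C ⥤ D) {A B : C} {A' B' : D}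

/-- `e₁ ≫ F g ≫ e₂` is an epimorphism when `g` is and `F` preserves epimorphisms. -/
theorem epi_conj [F.PreservesEpimorphisms] (e₁ : A' ≅ F.obj A) (e₂ : F.obj B ≅ B') (g : A ⟶ B)
    (hg : Epi g) : Epi (e₁.hom ≫ F.map g ≫ e₂.hom) := by
  haveI := hg
  haveI : Epi (F.map g) := Functor.map_epi F g
  haveI : Epi (F.map g ≫ e₂.hom) := epi_comp _ _
  exact epi_comp _ _

/-- `e₁ ≫ F g ≫ e₂` is an isomorphism when `g` is. -/
theorem isIso_conj (e₁ : A' ≅ F.obj A) (e₂ : F.obj B ≅ B') (g : A ⟶ B) (hg : IsIso g) :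
    IsIso (e₁.hom ≫ F.map g ≫ e₂.hom) := by
  haveI := hg
  haveI : IsIso (F.map g) := Functor.map_isIso F g
  haveI : IsIso (F.map g ≫ e₂.hom) := IsIso.comp_isIso
  exact IsIso.comp_isIso

end Transport

variable {X Y : Scheme.{u}} (f : X ⟶ Y)

set_option synthInstance.maxHeartbeats 200000 in
set_option maxHeartbeats 1600000 in
/-- From `π : 𝒪^I ⟶ E.over U` to a morphism `𝒪^I ⟶ (f^*E).over (f⁻¹U)`, epi if `π` is, iso if `π` is:
transport along Mathlib's `overEquiv` / `overFunctorEquiv`, the base change of module pull-back along the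
open immersion `U ↪ Y` (tree `KTheory.nonempty_restrictPullbackIso`) and `f^* 𝒪^I ≅ 𝒪^I`
(`KTheory.nonempty_pullbackFreeIso`). -/
theorem exists_hom_over_preimage (E : Y.Modules) (U : Y.Opens) (I : Type u)
    (π : SheafOfModules.free I ⟶ E.over U) :
    ∃ π' : SheafOfModules.free I ⟶ ((Scheme.Modules.pullback f).obj E).over (f ⁻¹ᵁ U),
      (Epi π → Epi π') ∧ (IsIso π → IsIso π') := by
  obtain ⟨e₀⟩ := Literature.AlgebraicGeometry.KTheory.nonempty_overEquivFreeIso U I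
  obtain ⟨e₁⟩ := Literature.AlgebraicGeometry.KTheory.nonempty_pullbackFreeIso (f ∣_ U) I
  obtain ⟨e₂⟩ := Literature.AlgebraicGeometry.KTheory.nonempty_restrictPullbackIso f U E
  obtain ⟨e₃⟩ := Literature.AlgebraicGeometry.KTheory.nonempty_overEquivInverseFreeIso (f ⁻¹ᵁ U) I
  haveI : (Scheme.Modules.pullback (f ∣_ U)).PreservesEpimorphisms :=
    Functor.preservesEpimorphisms_of_adjunction (Scheme.Modules.pullbackPushforwardAdjunction _)
  -- the three functors and the tail isomorphism
  let F₀ := (Scheme.Modules.overEquiv U).functor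
  let F₁ := Scheme.Modules.pullback (f ∣_ U)
  let F₂ := (Scheme.Modules.overEquiv (f ⁻¹ᵁ U)).inverse
  let i₀ : F₀.obj (E.over U) ≅ (Scheme.Modules.restrictFunctor U.ι).obj E :=
    (Scheme.Modules.overFunctorEquiv U).app E
  let tail : F₂.obj ((Scheme.Modules.restrictFunctor (f ⁻¹ᵁ U).ι).obj ((Scheme.Modules.pullback f).obj E)) ≅
      ((Scheme.Modules.pullback f).obj E).over (f ⁻¹ᵁ U) :=
    F₂.mapIso ((Scheme.Modules.overFunctorEquiv (f ⁻¹ᵁ U)).app ((Scheme.Modules.pullback f).obj E)).symm ≪≫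
      ((Scheme.Modules.overEquiv (f ⁻¹ᵁ U)).unitIso.app
        (((Scheme.Modules.pullback f).obj E).over (f ⁻¹ᵁ U))).symm
  -- the morphism in `(U : Scheme).Modules`, pulled back to `f⁻¹ U`, and back to the `over` form
  let a : SheafOfModules.free I ⟶ (Scheme.Modules.restrictFunctor U.ι).obj E :=
    e₀.hom ≫ F₀.map π ≫ i₀.hom
  let b : SheafOfModules.free I ⟶
      (Scheme.Modules.restrictFunctor (f ⁻¹ᵁ U).ι).obj ((Scheme.Modules.pullback f).obj E) :=
    e₁.symm.hom ≫ F₁.map a ≫ e₂.symm.hom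
  let c : SheafOfModules.free I ⟶ ((Scheme.Modules.pullback f).obj E).over (f ⁻¹ᵁ U) :=
    e₃.hom ≫ F₂.map b ≫ tail.hom
  refine ⟨c, fun hπ => ?_, fun hπ => ?_⟩
  · have ha : Epi a := epi_conj F₀ e₀ i₀ π hπ
    have hb : Epi b := epi_conj F₁ e₁.symm e₂.symm a ha
    exact epi_conj F₂ e₃ tail b hb
  · have ha : IsIso a := isIso_conj F₀ e₀ i₀ π hπ
    have hb : IsIso b := isIso_conj F₁ e₁.symm e₂.symm a ha
    exact isIso_conj F₂ e₃ tail b hb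

/-- An open cover of `Y` pulls back to an open cover of `X`. -/
theorem coversTop_preimage {ι : Type*} (U : ι → Y.Opens)
    (hU : (Opens.grothendieckTopology Y).CoversTop U) :
    (Opens.grothendieckTopology X).CoversTop fun i => f ⁻¹ᵁ U i := by
  refine (Opens.coversTop_iff _ _).mpr (TopologicalSpace.IsOpenCover.mk ?_)
  rw [← Scheme.Hom.preimage_iSup, ((Opens.coversTop_iff _ U).mp hU).iSup_eq_top,
    Scheme.Hom.preimage_top]

set_option synthInstance.maxHeartbeats 200000 in
set_option maxHeartbeats 1600000 in
/-- **Vector bundles pull back to vector bundles** (for the tree's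
`IsVectorBundle = IsLocallyFree ∧ IsFiniteType`; The Stacks Project, Tag 01C8): both halves are transported
cover-by-cover along `exists_hom_over_preimage` (isomorphisms `𝒪^I ≅ E|_U` for local freeness, epimorphisms
`𝒪^I ↠ E|_U` with `I` finite for finite type). The tree had only `IsFiniteLocallyFree.pullback` and the
one-directional bridge `IsFiniteLocallyFree → IsVectorBundle`; this closes the gap the idea card named
("IsVectorBundle ↔ IsFiniteLocallyFree bridge") without the bridge. -/
theorem isVectorBundle_pullback {E : Y.Modules} (hE : IsVectorBundle E) :
    IsVectorBundle ((Scheme.Modules.pullback f).obj E) := by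
  obtain ⟨⟨q, hq⟩, ⟨q', hq'⟩⟩ := hE
  -- locally free
  choose π₁ hπ₁ using fun i =>
    exists_hom_over_preimage f E (q.X i) (q.generators i).I (q.generators i).π
  have hiso : ∀ i, IsIso (π₁ i) := fun i => (hπ₁ i).2 (hq.isIso i)
  let r : SheafOfModules.LocalGeneratorsData.{u} ((Scheme.Modules.pullback f).obj E) :=
    { I := q.I
      X := fun i => f ⁻¹ᵁ q.X i
      coversTop := coversTop_preimage f q.X q.coversTop
      generators := fun i =>
        haveI := hiso i
        (SheafOfModules.free.generatingSections (q.generators i).I).ofEpi (π₁ i) }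
  have hr : r.IsLocallyFreeData :=
    { isIso := fun i => by
        haveI := hiso i
        change IsIso ((SheafOfModules.free.generatingSections (q.generators i).I).ofEpi (π₁ i)).π
        rw [SheafOfModules.GeneratingSections.ofEpi_π]
        change IsIso ((SheafOfModules.free.generatingSections (q.generators i).I).π ≫ π₁ i)
        infer_instance }
  -- finite type
  choose π₂ hπ₂ using fun i =>
    exists_hom_over_preimage f E (q'.X i) (q'.generators i).I (q'.generators i).π
  have hepi : ∀ i, Epi (π₂ i) := fun i => (hπ₂ i).1 inferInstance
  let r' : SheafOfModules.LocalGeneratorsData.{u} ((Scheme.Modules.pullback f).obj E) :=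
    { I := q'.I
      X := fun i => f ⁻¹ᵁ q'.X i
      coversTop := coversTop_preimage f q'.X q'.coversTop
      generators := fun i =>
        haveI := hepi i
        (SheafOfModules.free.generatingSections (q'.generators i).I).ofEpi (π₂ i) }
  have hr' : r'.IsFiniteType :=
    { isFiniteType := fun i => by
        haveI := hq'.isFiniteType i
        exact { finite := inferInstanceAs (Finite (q'.generators i).I) } }
  have h1 : SheafOfModules.IsLocallyFree.{u, u, u} ((Scheme.Modules.pullback f).obj E) :=
    { exists_isLocallyFreeData := ⟨r, hr⟩ }
  have h2 : SheafOfModules.IsFiniteType.{u, u, u} ((Scheme.Modules.pullback f).obj E) :=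
    { exists_localGeneratorsData := ⟨r', hr'⟩ }
  exact ⟨h1, h2⟩

end VectorBundlePullback

/-! ### §3.2 Tower bookkeeping: the base-changed morphism `ρ_n` and the transition maps

`thickeningMap_snd` (`X_m ⟶ X_n` lies over `Spec W_m ⟶ Spec W_n`) is IMPORTED from the landed negative file
`Theorems/FormalVectorBundlesAlgebraize/Negative/TowerTightness` of this crux (cdisprove cycle 1, §1), not re-proved. -/

section Tower

open Summit.HodgeConjecture.HodgeConjecture.Theorems.FormalVectorBundlesAlgebraize.Negative (thickeningMap_snd)

variable {p : ℕ} [Fact p.Prime] {k : Type} [Field k]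

/-- `ρ_n ≫ (X_n ⟶ 𝒳) = (X'_n ⟶ 𝒳') ≫ ρ` for the base change `ρ_n : X'_n ⟶ X_n` of a `W`-morphism. -/
theorem baseChange_map_left_ι {𝒳' 𝒳 : SchemeOver (WittVector p k)} (ρ : 𝒳' ⟶ 𝒳) (n : ℕ) :
    ((baseChange (WittVector p k) (wittQuot p k n)).map ρ).left ≫ thickeningι 𝒳 n =
      thickeningι 𝒳' n ≫ ρ.left :=
  pullback.lift_fst _ _ _

/-- `ρ_n` lies over the identity of `Spec W_n`. -/
theorem baseChange_map_left_snd {𝒳' 𝒳 : SchemeOver (WittVector p k)} (ρ : 𝒳' ⟶ 𝒳) (n : ℕ) :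
    ((baseChange (WittVector p k) (wittQuot p k n)).map ρ).left ≫ pullback.snd 𝒳.hom
        (Spec.map (CommRingCat.ofHom (algebraMap (WittVector p k) (wittQuot p k n)))) =
      pullback.snd 𝒳'.hom
        (Spec.map (CommRingCat.ofHom (algebraMap (WittVector p k) (wittQuot p k n)))) :=
  pullback.lift_snd _ _ _

/-- **Naturality of the tower**: `ρ_m ≫ (X_m ⟶ X_n) = (X'_m ⟶ X'_n) ≫ ρ_n`. -/
theorem baseChange_map_left_thickeningMap {𝒳' 𝒳 : SchemeOver (WittVector p k)} (ρ : 𝒳' ⟶ 𝒳)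
    {m n : ℕ} (h : m ≤ n) :
    ((baseChange (WittVector p k) (wittQuot p k m)).map ρ).left ≫ thickeningMap 𝒳 h =
      thickeningMap 𝒳' h ≫ ((baseChange (WittVector p k) (wittQuot p k n)).map ρ).left := by
  apply pullback.hom_ext
  · -- first projections: both sides are `(X'_m ⟶ 𝒳') ≫ ρ`
    have hl : (((baseChange (WittVector p k) (wittQuot p k m)).map ρ).left ≫ thickeningMap 𝒳 h) ≫
        thickeningι 𝒳 n = thickeningι 𝒳' m ≫ ρ.left :=
      (Category.assoc _ _ _).trans <|
        (congrArg (((baseChange (WittVector p k) (wittQuot p k m)).map ρ).left ≫ ·)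
          (thickeningMap_ι 𝒳 h)).trans (baseChange_map_left_ι ρ m)
    have hr : (thickeningMap 𝒳' h ≫ ((baseChange (WittVector p k) (wittQuot p k n)).map ρ).left) ≫
        thickeningι 𝒳 n = thickeningι 𝒳' m ≫ ρ.left :=
      (Category.assoc _ _ _).trans <|
        (congrArg (thickeningMap 𝒳' h ≫ ·) (baseChange_map_left_ι ρ n)).trans <|
          (Category.assoc _ _ _).symm.trans (congrArg (· ≫ ρ.left) (thickeningMap_ι 𝒳' h))
    exact hl.trans hr.symm
  · -- second projections: both sides are `(X'_m ⟶ Spec W_m) ≫ (Spec W_m ⟶ Spec W_n)`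
    have hl : (((baseChange (WittVector p k) (wittQuot p k m)).map ρ).left ≫ thickeningMap 𝒳 h) ≫
        pullback.snd 𝒳.hom (Spec.map (CommRingCat.ofHom (algebraMap (WittVector p k) (wittQuot p k n)))) =
        pullback.snd 𝒳'.hom (Spec.map (CommRingCat.ofHom (algebraMap (WittVector p k) (wittQuot p k m)))) ≫
          Spec.map (CommRingCat.ofHom (Ideal.Quotient.factor
            (Ideal.pow_le_pow_right (I := Ideal.span {(p : WittVector p k)}) h))) :=
      (Category.assoc _ _ _).trans <|
        (congrArg (((baseChange (WittVector p k) (wittQuot p k m)).map ρ).left ≫ ·)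
          (thickeningMap_snd 𝒳 h)).trans <|
          (Category.assoc _ _ _).symm.trans
            (congrArg (· ≫ Spec.map (CommRingCat.ofHom (Ideal.Quotient.factor
              (Ideal.pow_le_pow_right (I := Ideal.span {(p : WittVector p k)}) h))))
              (baseChange_map_left_snd ρ m))
    have hr : (thickeningMap 𝒳' h ≫ ((baseChange (WittVector p k) (wittQuot p k n)).map ρ).left) ≫
        pullback.snd 𝒳.hom (Spec.map (CommRingCat.ofHom (algebraMap (WittVector p k) (wittQuot p k n)))) =
        pullback.snd 𝒳'.hom (Spec.map (CommRingCat.ofHom (algebraMap (WittVector p k) (wittQuot p k m)))) ≫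
          Spec.map (CommRingCat.ofHom (Ideal.Quotient.factor
            (Ideal.pow_le_pow_right (I := Ideal.span {(p : WittVector p k)}) h))) :=
      (Category.assoc _ _ _).trans <|
        (congrArg (thickeningMap 𝒳' h ≫ ·) (baseChange_map_left_snd ρ n)).trans (thickeningMap_snd 𝒳' h)
    exact hl.trans hr.symm

/-- One step of the PULLED-BACK tower: from `E (n+1)|_{X_{n+1}} ≅ E n` to
`(ρ_{n+2}^* E (n+1))|_{X'_{n+1}} ≅ ρ_{n+1}^* E n` (pseudofunctoriality of `Scheme.Modules.pullback`
along the naturality square `baseChange_map_left_thickeningMap`). -/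
theorem towerPullbackStep {𝒳' 𝒳 : SchemeOver (WittVector p k)} (ρ : 𝒳' ⟶ 𝒳)
    (E : ∀ n : ℕ, (thickening 𝒳 (n + 1)).left.Modules) (n : ℕ)
    (s : (Scheme.Modules.pullback (thickeningMap 𝒳 (Nat.le_succ (n + 1)))).obj (E (n + 1)) ≅ E n) :
    Nonempty ((Scheme.Modules.pullback (thickeningMap 𝒳' (Nat.le_succ (n + 1)))).obj
        ((Scheme.Modules.pullback
          ((baseChange (WittVector p k) (wittQuot p k (n + 1 + 1))).map ρ).left).obj (E (n + 1))) ≅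
      (Scheme.Modules.pullback
        ((baseChange (WittVector p k) (wittQuot p k (n + 1))).map ρ).left).obj (E n)) := by
  -- notation
  let t' := thickeningMap 𝒳' (Nat.le_succ (n + 1))
  let t := thickeningMap 𝒳 (Nat.le_succ (n + 1))
  let ρ₂ := ((baseChange (WittVector p k) (wittQuot p k (n + 1 + 1))).map ρ).left
  let ρ₁ := ((baseChange (WittVector p k) (wittQuot p k (n + 1))).map ρ).left
  have sq : t' ≫ ρ₂ = ρ₁ ≫ t := (baseChange_map_left_thickeningMap ρ (Nat.le_succ (n + 1))).symm
  have i1 : (Scheme.Modules.pullback t').obj ((Scheme.Modules.pullback ρ₂).obj (E (n + 1))) ≅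
      (Scheme.Modules.pullback (t' ≫ ρ₂)).obj (E (n + 1)) :=
    (Scheme.Modules.pullbackComp t' ρ₂).app (E (n + 1))
  have i2 : (Scheme.Modules.pullback (t' ≫ ρ₂)).obj (E (n + 1)) ≅
      (Scheme.Modules.pullback (ρ₁ ≫ t)).obj (E (n + 1)) :=
    (Scheme.Modules.pullbackCongr sq).app (E (n + 1))
  have i3 : (Scheme.Modules.pullback (ρ₁ ≫ t)).obj (E (n + 1)) ≅
      (Scheme.Modules.pullback ρ₁).obj ((Scheme.Modules.pullback t).obj (E (n + 1))) :=
    ((Scheme.Modules.pullbackComp ρ₁ t).app (E (n + 1))).symm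
  have i4 : (Scheme.Modules.pullback ρ₁).obj ((Scheme.Modules.pullback t).obj (E (n + 1))) ≅
      (Scheme.Modules.pullback ρ₁).obj (E n) :=
    (Scheme.Modules.pullback ρ₁).mapIso s
  exact ⟨i1 ≪≫ i2 ≪≫ i3 ≪≫ i4⟩

end Tower

section Glue

variable {p : ℕ} [Fact p.Prime] {k : Type} [Field k] [CharP k p]

/-- **Last glue step:** a vector bundle `G` on `𝒳` with `G|_{X_1} ≅ E 0` and `E 0|_{X_k} ≅ E₁`
witnesses `LiftsTo 𝒳 E₁` (`X_k ⟶ X_1 ⟶ 𝒳 = X_k ⟶ 𝒳`, `specialFibreToThickening_ι`). -/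
theorem liftsTo_of_levelOne (𝒳 : SchemeOver (WittVector p k)) (G : 𝒳.left.Modules)
    (hG : IsVectorBundle G) (E₁ : (specialFibre 𝒳).left.Modules)
    (E0 : (thickening 𝒳 1).left.Modules)
    (e : (Scheme.Modules.pullback (thickeningι 𝒳 1)).obj G ≅ E0)
    (e₀ : (Scheme.Modules.pullback (specialFibreToThickening 𝒳 0)).obj E0 ≅ E₁) :
    LiftsTo 𝒳 E₁ :=
  ⟨G, hG, ⟨(Scheme.Modules.pullbackCongr (specialFibreToThickening_ι 𝒳 0).symm).app G ≪≫
      ((Scheme.Modules.pullbackComp (specialFibreToThickening 𝒳 0) (thickeningι 𝒳 1)).app G).symm ≪≫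
      (Scheme.Modules.pullback (specialFibreToThickening 𝒳 0)).mapIso e ≪≫ e₀⟩⟩

end Glue

/-! ## §4 The composition: the stubs imply the crux, BY NAME (kernel-checked; no `sorry`) -/

/-- **`FormalVectorBundlesAlgebraize_of`** — the glue of the line. Given a smooth proper model `𝒳`, a
module `E₁` on `X_k` and a formal lift `(E n)`: stub 1 makes `𝒳` integral, normal and onto `Spec W`; stub 2
gives the Chow cover `ρ : 𝒳' ⟶ 𝒳`; stub 3 gives `ρ_* 𝒪 = 𝒪`; the tower is pulled back to `𝒳'`
(`isVectorBundle_pullback`, `towerPullbackStep`); stub 4 algebraizes it on the `W`-projective flat `𝒳'`;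
stub 5 pushes the result forward to a vector bundle on `𝒳` restricting to `E 0` on `X_1`; `liftsTo_of_levelOne`
concludes. Shape = Disproof.lean's `crux_of_grothendieckExistenceVB` with `GrothendieckExistenceVB` replaced
by the five stubs; what is proved on the way is exactly the LEVEL-ONE form of the crux (Disproof.lean §6
`crux_iff_levelOne`: equivalent to the crux), nothing about the higher levels of `ρ_* E'`. The hypotheses are
the registered stubs BY NAME (`Registered.stub_*`), the conclusion is the route decl BY NAME; axioms of this
theorem: `propext`, `Classical.choice`, `Quot.sound` (no `sorryAx`). -/
theorem FormalVectorBundlesAlgebraize_of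
    (h1 : Registered.stub_integralNormal) (h2 : Registered.stub_chowCover)
    (h3 : Registered.stub_birationalOntoNormal) (h4 : Registered.stub_projectiveFlatEngine)
    (h5 : Registered.stub_pushforwardTransport) :
    Summit.HodgeConjecture.HodgeConjecture.Theses.PadicSemiregularLift.FormalVectorBundlesAlgebraize := by
  intro p _ k _ _ _ d 𝒳 h𝒳 E₁ hE
  obtain ⟨E, hEvb, hstep, ⟨e0⟩⟩ := hE
  obtain ⟨hint, hsurj, hnorm⟩ := h1 p k d 𝒳 h𝒳
  obtain ⟨𝒳', ρ, hint', hproj, hflat, hρp, hρs, hU⟩ := h2 p k 𝒳 h𝒳.isProper hint hsurj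
  have happ : ∀ V : 𝒳.left.Opens, IsIso (ρ.left.app V) :=
    h3 𝒳'.left 𝒳.left ρ.left hint' hint hnorm hρp hρs hU
  -- the pulled-back tower `F n := ρ_{n+1}^* (E n)` on `𝒳'`
  let F : ∀ n : ℕ, (thickening 𝒳' (n + 1)).left.Modules := fun n =>
    (Scheme.Modules.pullback ((baseChange (WittVector p k) (wittQuot p k (n + 1))).map ρ).left).obj (E n)
  have hFvb : ∀ n, IsVectorBundle (F n) := fun n => isVectorBundle_pullback _ (hEvb n)
  have hFstep : ∀ n, Nonempty ((Scheme.Modules.pullback (thickeningMap 𝒳' (Nat.le_succ (n + 1)))).obj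
      (F (n + 1)) ≅ F n) := fun n => by
    obtain ⟨s⟩ := hstep n
    exact towerPullbackStep ρ E n s
  -- algebraize on the Chow cover, push forward, conclude at level one
  obtain ⟨E', hE'vb, hE'⟩ := h4 p k 𝒳' hproj hflat F hFvb hFstep
  obtain ⟨hG, ⟨e⟩⟩ := h5 p k 𝒳 h𝒳.isProper 𝒳' ρ hρp happ hproj hflat E hEvb hstep E' hE'vb hE'
  exact liftsTo_of_levelOne 𝒳 _ hG E₁ (E 0) e e0

/-- Wiring check: the registered (sorried) stubs feed the composition as stated. -/
example : Summit.HodgeConjecture.HodgeConjecture.Theses.PadicSemiregularLift.FormalVectorBundlesAlgebraize :=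
  FormalVectorBundlesAlgebraize_of stub_integralNormal stub_chowCover stub_birationalOntoNormal
    stub_projectiveFlatEngine stub_pushforwardTransport

end Summit.HodgeConjecture.HodgeConjecture.Cruxes.FormalVectorBundlesAlgebraize.ChowZariskiPushforward

end
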